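import Mathlib
import Literature.MathematicalPhysics.QuantumManyBody.BoseEinsteinCondensation
import Literature.MathematicalPhysics.QuantumManyBody.NeumannBoxParseval
import Summits.AtomisticToContinuum.BoseEinsteinCondensation.Theorems.SoloBlindModeOccupation
import Summits.AtomisticToContinuum.BoseEinsteinCondensation.Theorems.SoloBlindInfraredBEC

/-!
# Weighted infrared criterion for BEC: any summable low-mode budget suffices

Solo seat `solo-AtomisticToContinuum-blind`, conjunct `BoseEinsteinCondensation`.

`SoloBlindInfraredBEC` proved: an infrared bound `N_k(Ψ) ≤ A/|k|` on the Neumann modes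
`0 ≠ k ∈ {0,…,M}³` plus a kinetic bound along the near-minimisers gives `HasGroundStateBEC`.
Here the shape `A/|k|` is replaced by an **arbitrary weight** `w k`: all the argument uses is the
budget `∑_{0 ≠ k ∈ {0,…,M}³} w k`.  This is the form needed when the spectral input on the torus side
is weaker than a Landau (linear) bound — e.g. a *quadratic* two-sided sector bound
`Λ_N(k) ≥ b k²`, which through the one-body `f`-sum rule gives `n_k ≤ 1/b + 2ρ‖v‖₁/(b k²)`, a weight
of shape `A + B/|k|²`.  In three dimensions `∑_{k ∈ {0,…,M}³} 1/|k|² ≤ 7M` (proved here by shells),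
so such a weight has budget `A (M+1)³ + 7 B M`, still `o(N)` for cutoffs `M ∼ K L/π` with `K³ ≪ ρ`.

* `sum_inv_normSq_le` : `∑_{k ∈ {0,…,M}³} 1/|k|² ≤ 7 M`;
* `sub_le_modeOccupation_zero_of_weight` : `N_0(Ψ) ≥ (n+1) - ∑_{0≠k∈{0,…,M}³} w k - T (L/(π(M+1)))²`;
* `hasGroundStateBEC_of_weighted_infrared_bound` : the weighted criterion for `HasGroundStateBEC v ρ`;
* `hasGroundStateBEC_of_infrared_bound_sq` : the corollary for weights `A + B/|k|²`.
-/

noncomputable section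

open MeasureTheory Filter Set
open scoped ENNReal NNReal Real

namespace Summit.AtomisticToContinuum.BoseEinsteinCondensation.Theorems

open Literature.MathematicalPhysics.QuantumManyBody.BoseGas
open Literature.MathematicalPhysics.QuantumManyBody.NeumannBox

/-! ### The lattice sum `∑_{k ∈ {0,…,M}³} 1/|k|² ≤ 7M` -/

/-- On the shell `{0,…,M+1}³ ∖ {0,…,M}³` some coordinate equals `M+1`, so `1/|k|² ≤ 1/(M+1)²`. -/
theorem one_div_normSq_le_of_mem_sdiff {M : ℕ} {k : Fin 3 → ℕ}
    (hk : k ∈ Fintype.piFinset (fun _ : Fin 3 => Finset.range (M + 2)) \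
      Fintype.piFinset (fun _ : Fin 3 => Finset.range (M + 1))) :
    1 / (∑ i, ((k i : ℕ) : ℝ) ^ 2) ≤ 1 / ((M : ℝ) + 1) ^ 2 := by
  rw [Finset.mem_sdiff, Fintype.mem_piFinset, Fintype.mem_piFinset] at hk
  obtain ⟨-, h2⟩ := hk
  push Not at h2
  obtain ⟨i, hi⟩ := h2
  rw [Finset.mem_range, not_lt] at hi
  have hi' : (M : ℝ) + 1 ≤ (k i : ℝ) := by exact_mod_cast hi
  have hle : ((M : ℝ) + 1) ^ 2 ≤ ∑ j, ((k j : ℕ) : ℝ) ^ 2 := by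
    calc ((M : ℝ) + 1) ^ 2 ≤ ((k i : ℕ) : ℝ) ^ 2 := by gcongr
      _ ≤ ∑ j, ((k j : ℕ) : ℝ) ^ 2 :=
        Finset.single_le_sum (f := fun j => ((k j : ℕ) : ℝ) ^ 2) (fun j _ => sq_nonneg _)
          (Finset.mem_univ i)
  have hpos : (0 : ℝ) < ((M : ℝ) + 1) ^ 2 := by positivity
  gcongr

/-- **The three-dimensional lattice sum** `∑_{k ∈ {0,…,M}³} 1/|k|² ≤ 7 M` (the term `k = 0` is
`1/0 = 0`).  By induction on shells: the shell `max kᵢ = M+1` has `3(M+1)² + 3(M+1) + 1` points, each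
contributing at most `1/(M+1)²`. -/
theorem sum_inv_normSq_le (M : ℕ) :
    ∑ k ∈ Fintype.piFinset (fun _ : Fin 3 => Finset.range (M + 1)),
        1 / (∑ i, ((k i : ℕ) : ℝ) ^ 2) ≤ 7 * (M : ℝ) := by
  induction M with
  | zero =>
    have h0 : Fintype.piFinset (fun _ : Fin 3 => Finset.range (0 + 1)) = {0} := by
      ext k
      simp only [zero_add, Fintype.mem_piFinset, Finset.range_one, Finset.mem_singleton,
        funext_iff, Pi.zero_apply]
    rw [h0, Finset.sum_singleton]
    simp
  | succ M ih =>
    have hsub : Fintype.piFinset (fun _ : Fin 3 => Finset.range (M + 1)) ⊆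
        Fintype.piFinset (fun _ : Fin 3 => Finset.range (M + 1 + 1)) :=
      Fintype.piFinset_subset _ _ fun _ => Finset.range_subset_range.mpr (by omega)
    rw [← Finset.sum_sdiff hsub]
    have hcard : (((Fintype.piFinset (fun _ : Fin 3 => Finset.range (M + 1 + 1)) \
        Fintype.piFinset (fun _ : Fin 3 => Finset.range (M + 1))).card : ℕ) : ℝ) =
        ((M : ℝ) + 2) ^ 3 - ((M : ℝ) + 1) ^ 3 := by
      rw [Finset.card_sdiff_of_subset hsub, Fintype.card_piFinset, Fintype.card_piFinset]
      simp only [Finset.card_range, Finset.prod_const, Finset.card_univ, Fintype.card_fin]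
      have hle : (M + 1) ^ 3 ≤ (M + 1 + 1) ^ 3 := Nat.pow_le_pow_left (by omega) 3
      rw [Nat.cast_sub hle]
      push_cast
      ring
    have hshell : ∑ k ∈ Fintype.piFinset (fun _ : Fin 3 => Finset.range (M + 1 + 1)) \
        Fintype.piFinset (fun _ : Fin 3 => Finset.range (M + 1)),
        1 / (∑ i, ((k i : ℕ) : ℝ) ^ 2) ≤
        (((M : ℝ) + 2) ^ 3 - ((M : ℝ) + 1) ^ 3) * (1 / ((M : ℝ) + 1) ^ 2) := by
      rw [← hcard]
      have := Finset.sum_le_card_nsmul _ _ (1 / ((M : ℝ) + 1) ^ 2)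
        (fun k hk => one_div_normSq_le_of_mem_sdiff hk)
      simpa [nsmul_eq_mul] using this
    have hpos : (0 : ℝ) < (M : ℝ) + 1 := by positivity
    have hpos2 : (0 : ℝ) < ((M : ℝ) + 1) ^ 2 := by positivity
    calc _ ≤ (((M : ℝ) + 2) ^ 3 - ((M : ℝ) + 1) ^ 3) * (1 / ((M : ℝ) + 1) ^ 2) + 7 * (M : ℝ) :=
          add_le_add hshell ih
      _ = (3 + 3 / ((M : ℝ) + 1) + 1 / ((M : ℝ) + 1) ^ 2) + 7 * (M : ℝ) := by
          field_simp
          ring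
      _ ≤ (3 + 3 + 1) + 7 * (M : ℝ) := by
          gcongr
          · rw [div_le_iff₀ hpos]
            linarith [(Nat.cast_nonneg M : (0 : ℝ) ≤ M)]
          · rw [div_le_one hpos2]
            nlinarith [(Nat.cast_nonneg M : (0 : ℝ) ≤ M)]
      _ = 7 * ((M + 1 : ℕ) : ℝ) := by
          push_cast
          ring

/-! ### The weighted infrared criterion -/

section Criterion

variable {n : ℕ} {L : ℝ}

/-- **The weighted infrared criterion (one trial state).**  If the low Neumann modes
`0 ≠ k ∈ {0,…,M}³` carry occupation `N_k(Ψ) ≤ w k` and `∫|∇Ψ|² ≤ T`, then the flat mode carries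
`N_0(Ψ) ≥ (n+1) - ∑_{0 ≠ k ∈ {0,…,M}³} w k - T (L/(π(M+1)))²`. -/
theorem sub_le_modeOccupation_zero_of_weight (hL : 0 < L) (Ψ : TrialState (n + 1) L) (M : ℕ)
    (w : (Fin 3 → ℕ) → ℝ≥0∞) (T : ℝ≥0∞) (hT : ∫⁻ X, kineticDensity Ψ.ψ X ≤ T)
    (hIR : ∀ k : Fin 3 → ℕ, k ≠ 0 → (∀ i, k i ≤ M) →
      (n + 1 : ℝ≥0∞) * ∫⁻ Y : Config n,
          ‖∫ x in box L, (mode L k x : ℂ) * Ψ.ψ (Matrix.vecCons x Y)‖ₑ ^ 2 ≤ w k) :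
    (n + 1 : ℝ≥0∞) -
        (∑ k ∈ (Fintype.piFinset fun _ : Fin 3 => Finset.range (M + 1)).erase 0, w k +
          T * ENNReal.ofReal ((L / (π * (M + 1))) ^ 2)) ≤
      (n + 1 : ℝ≥0∞) * ∫⁻ Y : Config n,
        ‖∫ x in box L, (mode L 0 x : ℂ) * Ψ.ψ (Matrix.vecCons x Y)‖ₑ ^ 2 := by
  set nocc : (Fin 3 → ℕ) → ℝ≥0∞ := fun k => (n + 1 : ℝ≥0∞) * ∫⁻ Y : Config n,
      ‖∫ x in box L, (mode L k x : ℂ) * Ψ.ψ (Matrix.vecCons x Y)‖ₑ ^ 2 with hnocc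
  change _ - _ ≤ nocc 0
  set C : Finset (Fin 3 → ℕ) := Fintype.piFinset fun _ : Fin 3 => Finset.range (M + 1) with hC
  have hmemC : ∀ k : Fin 3 → ℕ, k ∈ C ↔ ∀ i, k i ≤ M := by
    intro k
    simp [hC, Fintype.mem_piFinset, Finset.mem_range]
  have h0C : (0 : Fin 3 → ℕ) ∈ C := (hmemC 0).2 fun _ => by simp
  have htot : ∑' k, nocc k = (n + 1 : ℝ≥0∞) := tsum_modeOccupation_eq hL Ψ
  have hsplit : ∑' k, nocc k =
      nocc 0 + ∑ k ∈ C.erase 0, nocc k + ∑' k : ↥((C : Set (Fin 3 → ℕ))ᶜ), nocc k := by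
    rw [← ENNReal.sum_add_tsum_compl C, ← Finset.add_sum_erase C nocc h0C]
  -- the low modes
  have hlow : ∑ k ∈ C.erase 0, nocc k ≤ ∑ k ∈ C.erase 0, w k := by
    refine Finset.sum_le_sum fun k hk => ?_
    rw [Finset.mem_erase] at hk
    exact hIR k hk.1 ((hmemC k).1 hk.2)
  -- the high modes
  have hΛ0 : 0 < (π * ((M : ℝ) + 1) / L) ^ 2 := by positivity
  have hkey : ∀ k : Fin 3 → ℕ, k ∈ ((C : Set (Fin 3 → ℕ))ᶜ) →
      nocc k ≤ (ENNReal.ofReal ((π * ((M : ℝ) + 1) / L) ^ 2))⁻¹ *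
        (ENNReal.ofReal (∑ i, waveNumber L (k i) ^ 2) * nocc k) := by
    intro k hk
    rw [Set.mem_compl_iff, Finset.mem_coe, hmemC] at hk
    push Not at hk
    obtain ⟨i, hi⟩ := hk
    have hi' : (M : ℝ) + 1 ≤ (k i : ℝ) := by exact_mod_cast hi
    have hle : (π * ((M : ℝ) + 1) / L) ^ 2 ≤ ∑ j, waveNumber L (k j) ^ 2 := by
      calc (π * ((M : ℝ) + 1) / L) ^ 2 ≤ waveNumber L (k i) ^ 2 := by
            rw [waveNumber, mul_comm ((k i : ℕ) : ℝ) π]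
            gcongr
        _ ≤ ∑ j, waveNumber L (k j) ^ 2 := Finset.single_le_sum
            (f := fun j => waveNumber L (k j) ^ 2) (fun j _ => sq_nonneg _) (Finset.mem_univ i)
    calc nocc k = (ENNReal.ofReal ((π * ((M : ℝ) + 1) / L) ^ 2))⁻¹ *
          (ENNReal.ofReal ((π * ((M : ℝ) + 1) / L) ^ 2) * nocc k) := by
          rw [← mul_assoc, ENNReal.inv_mul_cancel (ENNReal.ofReal_pos.2 hΛ0).ne'
            ENNReal.ofReal_ne_top, one_mul]
      _ ≤ (ENNReal.ofReal ((π * ((M : ℝ) + 1) / L) ^ 2))⁻¹ *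
          (ENNReal.ofReal (∑ j, waveNumber L (k j) ^ 2) * nocc k) := by
          gcongr
  have htail : ∑' k : ↥((C : Set (Fin 3 → ℕ))ᶜ), nocc k ≤
      T * ENNReal.ofReal ((L / (π * (M + 1))) ^ 2) := by
    calc ∑' k : ↥((C : Set (Fin 3 → ℕ))ᶜ), nocc k
        ≤ ∑' k : ↥((C : Set (Fin 3 → ℕ))ᶜ), (ENNReal.ofReal ((π * ((M : ℝ) + 1) / L) ^ 2))⁻¹ *
            (ENNReal.ofReal (∑ i, waveNumber L ((k : Fin 3 → ℕ) i) ^ 2) * nocc k) :=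
          ENNReal.tsum_le_tsum fun k => hkey k k.2
      _ ≤ (ENNReal.ofReal ((π * ((M : ℝ) + 1) / L) ^ 2))⁻¹ *
            ∑' k : Fin 3 → ℕ, ENNReal.ofReal (∑ i, waveNumber L (k i) ^ 2) * nocc k := by
          rw [ENNReal.tsum_mul_left]
          gcongr
          exact ENNReal.tsum_comp_le_tsum_of_injective Subtype.val_injective
            (fun k : Fin 3 → ℕ => ENNReal.ofReal (∑ i, waveNumber L (k i) ^ 2) * nocc k)
      _ ≤ (ENNReal.ofReal ((π * ((M : ℝ) + 1) / L) ^ 2))⁻¹ * T := by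
          gcongr
          exact (tsum_waveNumber_sq_mul_modeOccupation_le hL Ψ).trans hT
      _ = T * ENNReal.ofReal ((L / (π * (M + 1))) ^ 2) := by
          rw [mul_comm, ← ENNReal.ofReal_inv_of_pos hΛ0, ← inv_pow, inv_div]
  -- assemble
  rw [tsub_le_iff_right]
  calc (n + 1 : ℝ≥0∞) = ∑' k, nocc k := htot.symm
    _ = nocc 0 + (∑ k ∈ C.erase 0, nocc k + ∑' k : ↥((C : Set (Fin 3 → ℕ))ᶜ), nocc k) := by
        rw [hsplit, add_assoc]
    _ ≤ nocc 0 + (∑ k ∈ C.erase 0, w k + T * ENNReal.ofReal ((L / (π * (M + 1))) ^ 2)) :=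
        add_le_add le_rfl (add_le_add hlow htail)

/-- **Weighted infrared bounds along the near-minimisers imply Bose–Einstein condensation.**
If for all large `N = n+1` there are `δ > 0`, a mode cutoff `M`, a weight `w` on the modes and a
kinetic budget `T` with `∑_{0 ≠ k ∈ {0,…,M}³} w k + T (L/(π(M+1)))² ≤ η N` (`L = (N/ρ)^{1/3}`,
`η < 1` fixed) such that every `N`-particle trial state of energy `≤ E₀ + δ` has kinetic energy
`≤ T` and low-mode occupations `N_k(Ψ) ≤ w k` (`0 ≠ k ∈ {0,…,M}³`), then `HasGroundStateBEC v ρ`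
holds with condensate fraction `1 - η`. -/
theorem hasGroundStateBEC_of_weighted_infrared_bound (v : ℝ → ℝ≥0∞) {ρ : ℝ} (hρ : 0 < ρ)
    {η : ℝ≥0∞} (hη : η < 1)
    (h : ∀ᶠ n : ℕ in atTop, ∃ δ : ℝ≥0∞, 0 < δ ∧ ∃ (M : ℕ) (w : (Fin 3 → ℕ) → ℝ≥0∞) (T : ℝ≥0∞),
      ∑ k ∈ (Fintype.piFinset fun _ : Fin 3 => Finset.range (M + 1)).erase 0, w k +
          T * ENNReal.ofReal ((sideLength ρ (n + 1) / (π * (M + 1))) ^ 2) ≤ η * (n + 1) ∧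
      ∀ Ψ : TrialState (n + 1) (sideLength ρ (n + 1)),
        energy v Ψ ≤ groundStateEnergy v (n + 1) (sideLength ρ (n + 1)) + δ →
        ∫⁻ X, kineticDensity Ψ.ψ X ≤ T ∧
        ∀ k : Fin 3 → ℕ, k ≠ 0 → (∀ i, k i ≤ M) →
          (n + 1 : ℝ≥0∞) * ∫⁻ Y : Config n, ‖∫ x in box (sideLength ρ (n + 1)),
              (mode (sideLength ρ (n + 1)) k x : ℂ) * Ψ.ψ (Matrix.vecCons x Y)‖ₑ ^ 2 ≤ w k) :
    HasGroundStateBEC v ρ := by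
  have h1η : 1 - η ≠ ∞ := ne_top_of_le_ne_top ENNReal.one_ne_top tsub_le_self
  refine ⟨(1 - η).toReal, ENNReal.toReal_pos (tsub_pos_of_lt hη).ne' h1η, ?_⟩
  rw [Filter.eventually_atTop] at h ⊢
  obtain ⟨n₀, hn₀⟩ := h
  refine ⟨n₀ + 1, fun N hN => ?_⟩
  obtain ⟨n, rfl⟩ : ∃ n, N = n + 1 := ⟨N - 1, by omega⟩
  obtain ⟨δ, hδ, M, w, T, harith, hΨ⟩ := hn₀ n (by omega)
  have hNpos : (0 : ℝ) < ((n + 1 : ℕ) : ℝ) := by exact_mod_cast Nat.succ_pos n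
  have hL : 0 < sideLength ρ (n + 1) := by
    rw [sideLength]
    exact Real.rpow_pos_of_pos (div_pos hNpos hρ) _
  refine le_condensateNumber v hδ fun Ψ hE => ?_
  obtain ⟨hT, hIR⟩ := hΨ Ψ hE
  calc ENNReal.ofReal ((1 - η).toReal * ((n + 1 : ℕ) : ℝ))
      = (1 - η) * (n + 1 : ℝ≥0∞) := by
        rw [ENNReal.ofReal_mul ENNReal.toReal_nonneg, ENNReal.ofReal_toReal h1η,
          ENNReal.ofReal_natCast]
        push_cast
        ring
    _ = (n + 1 : ℝ≥0∞) - η * (n + 1) := by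
        rw [ENNReal.sub_mul fun _ _ => by exact_mod_cast ENNReal.natCast_ne_top (n + 1), one_mul]
    _ ≤ (n + 1 : ℝ≥0∞) -
        (∑ k ∈ (Fintype.piFinset fun _ : Fin 3 => Finset.range (M + 1)).erase 0, w k +
          T * ENNReal.ofReal ((sideLength ρ (n + 1) / (π * (M + 1))) ^ 2)) :=
        tsub_le_tsub_left harith _
    _ ≤ (n + 1 : ℝ≥0∞) * ∫⁻ Y : Config n, ‖∫ x in box (sideLength ρ (n + 1)),
          (mode (sideLength ρ (n + 1)) 0 x : ℂ) * Ψ.ψ (Matrix.vecCons x Y)‖ₑ ^ 2 :=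
        sub_le_modeOccupation_zero_of_weight hL Ψ M w T hT hIR
    _ ≤ maxOccupation (n + 1) Ψ.ψ := modeOccupation_zero_le_maxOccupation hL Ψ

/-- The budget of the weight `A + B/|k|²` on `{0,…,M}³ ∖ {0}`: at most `A (M+1)³ + 7 B M`. -/
theorem sum_weight_sq_le (M : ℕ) (A B : ℝ≥0∞) :
    ∑ k ∈ (Fintype.piFinset fun _ : Fin 3 => Finset.range (M + 1)).erase 0,
        (A + B / ENNReal.ofReal (∑ i, ((k i : ℕ) : ℝ) ^ 2)) ≤
      A * ((M : ℝ≥0∞) + 1) ^ 3 + 7 * B * (M : ℝ≥0∞) := by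
  set C : Finset (Fin 3 → ℕ) := Fintype.piFinset fun _ : Fin 3 => Finset.range (M + 1) with hC
  rw [Finset.sum_add_distrib]
  refine add_le_add ?_ ?_
  · rw [Finset.sum_const, nsmul_eq_mul, mul_comm]
    gcongr
    have hcard : ((C.erase 0).card : ℝ≥0∞) ≤ ((M : ℝ≥0∞) + 1) ^ 3 := by
      calc ((C.erase 0).card : ℝ≥0∞) ≤ (C.card : ℝ≥0∞) := by
            exact_mod_cast Finset.card_erase_le
        _ = ((M : ℝ≥0∞) + 1) ^ 3 := by
            rw [hC, Fintype.card_piFinset]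
            simp only [Finset.card_range, Finset.prod_const, Finset.card_univ, Fintype.card_fin]
            push_cast
            ring
    exact hcard
  · calc ∑ k ∈ C.erase 0, B / ENNReal.ofReal (∑ i, ((k i : ℕ) : ℝ) ^ 2)
        = ∑ k ∈ C.erase 0, B * ENNReal.ofReal (1 / ∑ i, ((k i : ℕ) : ℝ) ^ 2) := by
          refine Finset.sum_congr rfl fun k hk => ?_
          rw [Finset.mem_erase] at hk
          have hk0 : k ≠ 0 := hk.1
          have hpos : 0 < ∑ i, ((k i : ℕ) : ℝ) ^ 2 := by
            obtain ⟨i, hi⟩ : ∃ i, k i ≠ 0 := by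
              by_contra hcon
              push Not at hcon
              exact hk0 (funext hcon)
            calc (0 : ℝ) < (k i : ℝ) ^ 2 := by positivity
              _ ≤ ∑ j, (k j : ℝ) ^ 2 := Finset.single_le_sum (f := fun j => (k j : ℝ) ^ 2)
                  (fun j _ => sq_nonneg _) (Finset.mem_univ i)
          rw [div_eq_mul_inv, one_div, ENNReal.ofReal_inv_of_pos hpos]
      _ = B * ENNReal.ofReal (∑ k ∈ C.erase 0, 1 / ∑ i, ((k i : ℕ) : ℝ) ^ 2) := by
          rw [← Finset.mul_sum, ENNReal.ofReal_sum_of_nonneg fun k _ => by positivity]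
      _ ≤ B * ENNReal.ofReal (7 * (M : ℝ)) := by
          gcongr
          calc ∑ k ∈ C.erase 0, 1 / ∑ i, ((k i : ℕ) : ℝ) ^ 2
              ≤ ∑ k ∈ C, 1 / ∑ i, ((k i : ℕ) : ℝ) ^ 2 :=
                Finset.sum_le_sum_of_subset_of_nonneg (Finset.erase_subset 0 C)
                  fun k _ _ => by positivity
            _ ≤ 7 * (M : ℝ) := sum_inv_normSq_le M
      _ = 7 * B * (M : ℝ≥0∞) := by
          rw [show (7 : ℝ) * (M : ℝ) = ((7 * M : ℕ) : ℝ) by push_cast; ring,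
            ENNReal.ofReal_natCast]
          push_cast
          ring

/-- **Quadratic infrared bounds imply BEC.**  If along the near-minimisers the low Neumann modes
obey `N_k(Ψ) ≤ A + B/|k|²` (`0 ≠ k ∈ {0,…,M}³`) and `∫|∇Ψ|² ≤ T` with
`A (M+1)³ + 7 B M + T (L/(π(M+1)))² ≤ η N`, `η < 1`, then `HasGroundStateBEC v ρ`.  This is the
shape produced on the torus by a two-sided sector bound `Λ_N(k) ≥ b k²` through the `f`-sum rule
(`n_k ≤ (k² + 2ρ‖v‖₁)/(b k²)`). -/
theorem hasGroundStateBEC_of_infrared_bound_sq (v : ℝ → ℝ≥0∞) {ρ : ℝ} (hρ : 0 < ρ)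
    {η : ℝ≥0∞} (hη : η < 1)
    (h : ∀ᶠ n : ℕ in atTop, ∃ δ : ℝ≥0∞, 0 < δ ∧ ∃ (M : ℕ) (A B T : ℝ≥0∞),
      A * ((M : ℝ≥0∞) + 1) ^ 3 + 7 * B * (M : ℝ≥0∞) +
          T * ENNReal.ofReal ((sideLength ρ (n + 1) / (π * (M + 1))) ^ 2) ≤ η * (n + 1) ∧
      ∀ Ψ : TrialState (n + 1) (sideLength ρ (n + 1)),
        energy v Ψ ≤ groundStateEnergy v (n + 1) (sideLength ρ (n + 1)) + δ →
        ∫⁻ X, kineticDensity Ψ.ψ X ≤ T ∧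
        ∀ k : Fin 3 → ℕ, k ≠ 0 → (∀ i, k i ≤ M) →
          (n + 1 : ℝ≥0∞) * ∫⁻ Y : Config n, ‖∫ x in box (sideLength ρ (n + 1)),
              (mode (sideLength ρ (n + 1)) k x : ℂ) * Ψ.ψ (Matrix.vecCons x Y)‖ₑ ^ 2 ≤
            A + B / ENNReal.ofReal (∑ i, ((k i : ℕ) : ℝ) ^ 2)) :
    HasGroundStateBEC v ρ := by
  refine hasGroundStateBEC_of_weighted_infrared_bound v hρ hη ?_
  filter_upwards [h] with n hn
  obtain ⟨δ, hδ, M, A, B, T, harith, hΨ⟩ := hn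
  refine ⟨δ, hδ, M, fun k => A + B / ENNReal.ofReal (∑ i, ((k i : ℕ) : ℝ) ^ 2), T, ?_, hΨ⟩
  calc ∑ k ∈ (Fintype.piFinset fun _ : Fin 3 => Finset.range (M + 1)).erase 0,
          (A + B / ENNReal.ofReal (∑ i, ((k i : ℕ) : ℝ) ^ 2)) +
        T * ENNReal.ofReal ((sideLength ρ (n + 1) / (π * (M + 1))) ^ 2)
      ≤ A * ((M : ℝ≥0∞) + 1) ^ 3 + 7 * B * (M : ℝ≥0∞) +
        T * ENNReal.ofReal ((sideLength ρ (n + 1) / (π * (M + 1))) ^ 2) :=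
        add_le_add (sum_weight_sq_le M A B) le_rfl
    _ ≤ η * (n + 1) := harith

end Criterion

end Summit.AtomisticToContinuum.BoseEinsteinCondensation.Theorems

end
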